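import Literature.Geometry.Lorentzian.AchronalBoundaryProofs
import Literature.Geometry.Lorentzian.Stationary
import Mathlib.Topology.MetricSpace.Thickening
import HarnessLib

/-!
# Stub `stub_hr_sandwich` (HR-S) of crux `HawkingExtensionIsKerr`, line `SketchIdeator2`

**The null sandwich.**  Let `S` be an achronal set of a time-oriented Lorentzian manifold
without boundary (for the stub: the event horizon side `S = ∂I⁻(M_ext)` of a
`StationaryAFBlackHole`, the boundary of the past set `I⁻(M_ext)`, achronal by
`LorentzianMetric.IsPastSet.isAchronal_frontier`), and let `γ` be a curve running inside `S` for
`t ∈ (-ε, ε)` through `x₀ = γ 0` with a null, future-directed velocity `L` at `0`.  Read in the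
extended chart `φ` at a point `p` (with `x₀` in the chart domain) and the tangent-bundle
trivialization `e` at `p`, the points `φ⁻¹ z ∈ S` with `z` near `φ x₀` lie in the thin double
cone `|g(e⁻¹(z - φ x₀), L)| ≤ μ ‖z - φ x₀‖` about the null hyperplane `L^⊥`, for every `μ > 0`
(`hrSandwich_of_isAchronal`; the stub `stub_hr_sandwich` is its specialisation).  This is the
differentiability of horizons at interior points of generators (Beem–Królak 1998), in the form
consumed by programme HR (horizon regularity) of the line.

Proof.  With `B(u, w) = g(e⁻¹ u, e⁻¹ w)` the metric at `x₀` in the chart and `L̂ = e L`,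
`T̂ = e T_{x₀}`: (1) cone algebra (`hrSandwich_coneTilt`): for `lam` large, every `v` with
`‖v‖ ≤ 1`, `B(v, L̂) ≤ -μ` has `v + lam L̂` future timelike at `x₀`
(`B(v + lam L̂, v + lam L̂) = B(v,v) + 2 lam B(v, L̂) ≤ ‖B‖ - 2 lam μ`); (2) these pairs
`(φ x₀, v + lam L̂)` form a compact subset of the open chart cone
(`LorentzianMetric.isOpen_chartCone`), whence a uniform thickening radius `ρ`
(`IsCompact.exists_thickening_subset_open`); (3) the chart curve `φ ∘ γ` has derivative `L̂` at
`0` (`LorentzianMetric.hasDerivAt_extChartAt_comp`), so `φ(γ(±s)) = φ x₀ ± s L̂ + o(s)`;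
(4) for `z = φ x₀ + y` with `φ⁻¹ z ∈ S` and `B(y, L̂) < -μ‖y‖`, the straight chart segment from
`φ(γ(-s))`, `s = lam ‖y‖`, to `z` has direction `≈ ‖y‖ (y/‖y‖ + lam L̂)`, inside the thickened
cone, so it is a future timelike curve (`LorentzianMetric.mem_chronologicalFuture_symm_line`) from
`γ(-s) ∈ S` to `φ⁻¹ z ∈ S`, contradicting achronality; if `B(y, L̂) > μ‖y‖`, the segment from `z`
to `φ(γ(s))` does the same.
-/

noncomputable section

set_option linter.dupNamespace false

namespace Summit.FinalStateConjecture.FinalStateConjecture.Theorems.HawkingExtensionIsKerr.SketchIdeator2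

open Set Filter Metric Bundle Literature.Geometry.Lorentzian
open scoped Manifold ContDiff Topology

section General

variable {E : Type*} [NormedAddCommGroup E] [NormedSpace ℝ E] {H : Type*} [TopologicalSpace H]
  {I : ModelWithCorners ℝ E H} {n : ℕ∞ω} {M : Type*} [TopologicalSpace M] [ChartedSpace H M]

/-- Velocity of a curve with a prescribed manifold derivative `dγ_t = 1 ⊗ w`. [folklore] -/
theorem hrSandwich_velocity_eq {γ : ℝ → M} {t : ℝ} {w : TangentSpace I (γ t)}
    (h : HasMFDerivAt 𝓘(ℝ, ℝ) I γ t ((1 : ℝ →L[ℝ] ℝ).smulRight w)) : velocity I γ t = w := by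
  unfold velocity
  rw [h.mfderiv]
  change ((1 : ℝ →L[ℝ] ℝ) (1 : ℝ)) • w = w
  rw [show ((1 : ℝ →L[ℝ] ℝ) (1 : ℝ)) = 1 from rfl, one_smul]

/-- **Cone algebra: tilting a unit vector strictly below the null hyperplane `L̂^⊥` by a large
multiple of the null vector `L̂` makes it future timelike.**  For a symmetric continuous bilinear
form `B` with `B(L̂, L̂) = 0`, `B(T̂, L̂) < 0` and `μ > 0` there is `lam > 0` with
`B(v + lam L̂, v + lam L̂) < 0` and `B(T̂, v + lam L̂) < 0` whenever `‖v‖ ≤ 1`, `B(v, L̂) ≤ -μ`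
(`B(v + lam L̂, v + lam L̂) = B(v, v) + 2 lam B(v, L̂) ≤ ‖B‖ - 2 lam μ` and
`B(T̂, v + lam L̂) ≤ ‖B‖‖T̂‖ + lam B(T̂, L̂)`).  File-internal form (one admissible `lam`) of the
cone algebra of programme HR. [folklore] -/
private theorem hrSandwich_coneTilt {B : E →L[ℝ] E →L[ℝ] ℝ} {Lc Tc : E} {μ : ℝ}
    (hsymm : ∀ u w, B u w = B w u) (hLL : B Lc Lc = 0) (hTL : B Tc Lc < 0) (hμ : 0 < μ) :
    ∃ lam : ℝ, 0 < lam ∧ ∀ v : E, ‖v‖ ≤ 1 → B v Lc ≤ -μ →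
      B (v + lam • Lc) (v + lam • Lc) < 0 ∧ B Tc (v + lam • Lc) < 0 := by
  have hneg : 0 < -B Tc Lc := by linarith
  obtain ⟨lam, hlam⟩ : ∃ lam : ℝ, lam = (‖B‖ + 1) / μ + (‖B‖ * ‖Tc‖ + 1) / (-B Tc Lc) :=
    ⟨_, rfl⟩
  have hd1 : 0 < (‖B‖ + 1) / μ := by positivity
  have hd2 : 0 < (‖B‖ * ‖Tc‖ + 1) / (-B Tc Lc) := div_pos (by positivity) hneg
  have hlam0 : 0 < lam := by rw [hlam]; linarith
  have hlam1 : ‖B‖ + 1 ≤ lam * μ := by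
    have : (‖B‖ + 1) / μ ≤ lam := by rw [hlam]; linarith
    rwa [div_le_iff₀ hμ] at this
  have hlam2 : ‖B‖ * ‖Tc‖ + 1 ≤ lam * (-B Tc Lc) := by
    have : (‖B‖ * ‖Tc‖ + 1) / (-B Tc Lc) ≤ lam := by rw [hlam]; linarith
    rwa [div_le_iff₀ hneg] at this
  refine ⟨lam, hlam0, fun v hv hvL ↦ ⟨?_, ?_⟩⟩
  · have e1 : B (v + lam • Lc) (v + lam • Lc) = B v v + 2 * lam * B v Lc := by
      simp only [map_add, map_smul, add_apply, smul_apply, smul_eq_mul, hLL, hsymm Lc v]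
      ring
    have e2 : B v v ≤ ‖B‖ := by
      have h := B.le_opNorm₂ v v
      rw [Real.norm_eq_abs] at h
      have h' : ‖B‖ * ‖v‖ * ‖v‖ ≤ ‖B‖ := by
        have := mul_le_mul hv hv (norm_nonneg v) zero_le_one
        nlinarith [norm_nonneg B]
      linarith [le_abs_self (B v v)]
    rw [e1]
    nlinarith [mul_le_mul_of_nonneg_left hvL hlam0.le, norm_nonneg B]
  · have e1 : B Tc (v + lam • Lc) = B Tc v + lam * B Tc Lc := by
      simp only [map_add, map_smul, smul_eq_mul]
    have e2 : B Tc v ≤ ‖B‖ * ‖Tc‖ := by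
      have h := B.le_opNorm₂ Tc v
      rw [Real.norm_eq_abs] at h
      have h' : ‖B‖ * ‖Tc‖ * ‖v‖ ≤ ‖B‖ * ‖Tc‖ :=
        mul_le_of_le_one_right (by positivity) hv
      linarith [le_abs_self (B Tc v)]
    rw [e1]
    linarith

/-- **The null sandwich of an achronal set along a null curve** (manifold without boundary,
finite-dimensional model).  Let `S ⊆ M` be achronal and let `γ` run inside `S` for
`t ∈ (-ε, ε)`, with `γ 0 = x₀` and velocity `L` at `0` which is null (`g(L, L) = 0`) and
future-directed (`g(T, L) < 0`).  Then in the extended chart `φ` at any point `p` whose chart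
domain contains `x₀`, and with `e` the trivialization of `TM` at `p`: for every `μ > 0`, the
points `φ⁻¹ z ∈ S` with `z` close to `φ x₀` satisfy `|g_{x₀}(e⁻¹(z - φ x₀), L)| ≤ μ ‖z - φ x₀‖`
(otherwise a straight chart segment from `γ(-s)` to `φ⁻¹ z`, or from `φ⁻¹ z` to `γ(s)`,
`s = lam ‖z - φ x₀‖`, would be a future timelike curve joining two points of `S`).
This is the causal core of the differentiability of achronal boundaries (horizons) at interior
points of their null generators (J. K. Beem, A. Królak, *Cauchy horizon end points and
differentiability*, J. Math. Phys. 39 (1998) 6001–6010), in the tree's chart-cone vocabulary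
(`LorentzianMetric.chartCone`, `LorentzianMetric.mem_chronologicalFuture_symm_line`). [folklore] -/
theorem hrSandwich_of_isAchronal [FiniteDimensional ℝ E] [IsManifold I ∞ M]
    [BoundarylessManifold I M] {g : LorentzianMetric I n M} {τ : TimeOrientation g}
    {S : Set M} (hS : g.IsAchronal τ S) {p x₀ : M} {L : TangentSpace I x₀} {γ : ℝ → M} {ε : ℝ}
    (hx₀ : x₀ ∈ (chartAt H p).source) (hε : 0 < ε) (hγ0 : γ 0 = x₀)
    (hγd : HasMFDerivAt 𝓘(ℝ, ℝ) I γ 0 ((1 : ℝ →L[ℝ] ℝ).smulRight L))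
    (hLL : g.val x₀ L L = 0) (hTL : g.val x₀ (τ.vectorField x₀) L < 0)
    (hγS : ∀ t ∈ Ioo (-ε) ε, γ t ∈ S) {μ : ℝ} (hμ : 0 < μ) :
    ∀ᶠ z in 𝓝 (extChartAt I p x₀), (extChartAt I p).symm z ∈ S →
      |g.val x₀ ((trivializationAt E (TangentSpace I) p).symmL ℝ x₀ (z - extChartAt I p x₀)) L|
        ≤ μ * ‖z - extChartAt I p x₀‖ := by
  subst hγ0
  -- notation: the chart `φ`, the trivialization `e`, the centre `c₀ = φ x₀`
  set φ := extChartAt I p with hφ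
  set e := trivializationAt E (TangentSpace I) p with he
  set c₀ : E := φ (γ 0) with hc₀
  have hx₀e : γ 0 ∈ e.baseSet := by
    rw [he, TangentBundle.trivializationAt_baseSet]; exact hx₀
  have hx₀s : γ 0 ∈ φ.source := by rw [hφ, extChartAt_source]; exact hx₀
  have hc₀t : c₀ ∈ φ.target := φ.map_source hx₀s
  have hc₀symm : φ.symm c₀ = γ 0 := φ.left_inv hx₀s
  have hc₀int : c₀ ∈ interior (range I) := by
    have h := (ModelWithCorners.isInteriorPoint_iff_of_mem_atlas (I := I) (n := ∞) (by simp)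
      (chart_mem_atlas H p) hx₀).mp BoundarylessManifold.isInteriorPoint
    exact OpenPartialHomeomorph.interior_extend_target_subset_interior_range _ h
  -- the chart vectors `L̂ = e L`, `T̂ = e T`
  obtain ⟨Lc, hLc⟩ : ∃ Lc : E, Lc = e.continuousLinearMapAt ℝ (γ 0) L := ⟨_, rfl⟩
  obtain ⟨Tc, hTc⟩ : ∃ Tc : E, Tc = e.continuousLinearMapAt ℝ (γ 0) (τ.vectorField (γ 0)) :=
    ⟨_, rfl⟩
  have hLc' : e.symmL ℝ (γ 0) Lc = L := by rw [hLc, e.symmL_continuousLinearMapAt hx₀e]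
  have hTc' : e.symmL ℝ (γ 0) Tc = τ.vectorField (γ 0) := by
    rw [hTc, e.symmL_continuousLinearMapAt hx₀e]
  -- the metric at `x₀` read in the chart
  obtain ⟨B, hB⟩ : ∃ B : E →L[ℝ] E →L[ℝ] ℝ, ∀ u w : E,
      B u w = g.val (γ 0) (e.symmL ℝ (γ 0) u) (e.symmL ℝ (γ 0) w) :=
    ⟨ContinuousLinearMap.bilinearComp (show E →L[ℝ] E →L[ℝ] ℝ from g.val (γ 0))
      (show E →L[ℝ] E from e.symmL ℝ (γ 0)) (show E →L[ℝ] E from e.symmL ℝ (γ 0)),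
      fun _ _ ↦ rfl⟩
  have hBsymm : ∀ u w, B u w = B w u := fun u w ↦ by rw [hB, hB, g.symm]
  have hBLL : B Lc Lc = 0 := by rw [hB, hLc', hLL]
  have hBTL : B Tc Lc < 0 := by rw [hB, hTc', hLc']; exact hTL
  -- Step 1: cone algebra at `x₀`
  obtain ⟨lam, hlam, hcone⟩ := hrSandwich_coneTilt hBsymm hBLL hBTL hμ
  -- Step 2: the tilted vectors lie in the (open) chart cone over `c₀`
  set K := LorentzianMetric.chartCone g τ p with hK
  have hKo : IsOpen K := LorentzianMetric.isOpen_chartCone g τ p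
  have hmemK : ∀ v : E, ‖v‖ ≤ 1 → B v Lc ≤ -μ → (c₀, v + lam • Lc) ∈ K := by
    intro v hv hvL
    obtain ⟨h1, h2⟩ := hcone v hv hvL
    refine LorentzianMetric.mem_chartCone_iff.mpr ⟨⟨hc₀t, hc₀int⟩, ?_⟩
    rw [hc₀symm]
    rw [hB] at h1
    rw [hB, hTc'] at h2
    exact ⟨h1, h2⟩
  -- Step 3: a uniform thickening of the compact family inside the open chart cone
  obtain ⟨ρ, hρ, hρK⟩ : ∃ ρ > 0, ∀ z w v : E, ‖v‖ ≤ 1 → B v Lc ≤ -μ → ‖z - c₀‖ < ρ →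
      ‖w - (v + lam • Lc)‖ < ρ → (z, w) ∈ K := by
    obtain ⟨A₀, hA₀⟩ : ∃ A₀ : Set E, A₀ = {v | ‖v‖ ≤ 1 ∧ B v Lc ≤ -μ} := ⟨_, rfl⟩
    have hcont : Continuous fun v : E ↦ B v Lc := B.continuous.clm_apply continuous_const
    have hA₀c : IsCompact A₀ := by
      refine (isCompact_closedBall (0 : E) 1).of_isClosed_subset ?_ ?_
      · rw [hA₀]
        exact (isClosed_le continuous_norm continuous_const).inter
          (isClosed_le hcont continuous_const)
      · intro v hv
        rw [hA₀] at hv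
        exact mem_closedBall_zero_iff.mpr hv.1
    obtain ⟨f, hf⟩ : ∃ f : E → E × E, f = fun v ↦ (c₀, v + lam • Lc) := ⟨_, rfl⟩
    have hfc : Continuous f := by rw [hf]; fun_prop
    have hsub : f '' A₀ ⊆ K := by
      rintro _ ⟨v, hv, rfl⟩
      rw [hA₀] at hv
      rw [hf]
      exact hmemK v hv.1 hv.2
    obtain ⟨ρ, hρ, hρK⟩ := (hA₀c.image hfc).exists_thickening_subset_open hKo hsub
    refine ⟨ρ, hρ, fun z w v hv hvL hz hw ↦ hρK ?_⟩
    rw [Metric.mem_thickening_iff]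
    refine ⟨f v, ⟨v, by rw [hA₀]; exact ⟨hv, hvL⟩, rfl⟩, ?_⟩
    rw [Prod.dist_eq, hf, dist_eq_norm, dist_eq_norm]
    exact max_lt hz hw
  -- the scaled form of Step 3
  have hρK' : ∀ (z w v : E) (c : ℝ), 0 < c → ‖v‖ ≤ c → B v Lc ≤ -μ * c → ‖z - c₀‖ < ρ →
      ‖w - (v + (c * lam) • Lc)‖ < ρ * c → (z, w) ∈ K := by
    intro z w v c hc hv hvL hz hw
    have h1 : ‖c⁻¹ • v‖ ≤ 1 := by
      rw [norm_smul, norm_inv, Real.norm_eq_abs, abs_of_pos hc, inv_mul_le_iff₀ hc, mul_one]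
      exact hv
    have h2 : B (c⁻¹ • v) Lc ≤ -μ := by
      rw [map_smul, smul_apply, smul_eq_mul, inv_mul_le_iff₀ hc]
      linarith
    have h3 : ‖c⁻¹ • w - (c⁻¹ • v + lam • Lc)‖ < ρ := by
      have e1 : c⁻¹ • w - (c⁻¹ • v + lam • Lc) = c⁻¹ • (w - (v + (c * lam) • Lc)) := by
        rw [smul_sub, smul_add, mul_smul, inv_smul_smul₀ hc.ne']
      rw [e1, norm_smul, norm_inv, Real.norm_eq_abs, abs_of_pos hc, inv_mul_lt_iff₀ hc,
        mul_comm c ρ]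
      exact hw
    have h4 := LorentzianMetric.smul_mem_chartCone (hρK z _ _ h1 h2 hz h3) hc
    rwa [smul_inv_smul₀ hc.ne'] at h4
  -- straight chart segments with such data are future timelike curves
  have hseg : ∀ (x w v : E) (c : ℝ), 0 < c → ‖v‖ ≤ c → B v Lc ≤ -μ * c →
      ‖w - (v + (c * lam) • Lc)‖ < ρ * c → ‖x - c₀‖ < ρ → ‖x + w - c₀‖ < ρ →
      φ.symm (x + w) ∈ g.chronologicalFuture τ {φ.symm x} := by
    intro x w v c hc hv hvL hw hx hxw
    have h := LorentzianMetric.mem_chronologicalFuture_symm_line (g := g) (τ := τ) (q := p)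
      (z := x) (v := w) zero_lt_one (fun t ht ↦ ?_)
    · rwa [one_smul, zero_smul, add_zero] at h
    refine hρK' _ _ v c hc hv hvL ?_ hw
    have hmem : (1 - t) • x + t • (x + w) ∈ ball c₀ ρ :=
      (convex_ball c₀ ρ) (mem_ball_iff_norm.mpr hx) (mem_ball_iff_norm.mpr hxw)
        (sub_nonneg.mpr ht.2) ht.1 (sub_add_cancel 1 t)
    have e1 : (1 - t) • x + t • (x + w) = x + t • w := by module
    rw [e1, mem_ball_iff_norm] at hmem
    exact hmem
  -- Step 4: the chart curve `φ ∘ γ` has derivative `L̂` at `0`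
  have hvel : velocity I γ 0 = L := hrSandwich_velocity_eq hγd
  have hcd : HasDerivAt (φ ∘ γ) Lc 0 := by
    have h := LorentzianMetric.hasDerivAt_extChartAt_comp (I := I) (q := p)
      hγd.mdifferentiableAt hx₀
    rw [hvel] at h
    rw [hLc]
    exact h
  set θ : ℝ := ρ / (2 * lam) with hθ
  have hθ0 : 0 < θ := by positivity
  have hθlam : θ * lam = ρ / 2 := by rw [hθ]; field_simp
  have hev1 : ∀ᶠ t in 𝓝 (0 : ℝ), ‖(φ ∘ γ) t - (φ ∘ γ) 0 - (t - 0) • Lc‖ ≤ θ * ‖t - 0‖ :=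
    (hasDerivAt_iff_isLittleO.mp hcd).def hθ0
  have hev2 : ∀ᶠ t in 𝓝 (0 : ℝ), γ t ∈ (chartAt H p).source :=
    hγd.continuousAt.preimage_mem_nhds ((chartAt H p).open_source.mem_nhds hx₀)
  have hev3 : ∀ᶠ t in 𝓝 (0 : ℝ), t ∈ Ioo (-ε) ε := Ioo_mem_nhds (by linarith) hε
  obtain ⟨δ₁, hδ₁, hδ⟩ := Metric.eventually_nhds_iff.mp (hev1.and (hev2.and hev3))
  have hcurve : ∀ t : ℝ, |t| < δ₁ →
      ‖φ (γ t) - c₀ - t • Lc‖ ≤ θ * |t| ∧ γ t ∈ S ∧ φ.symm (φ (γ t)) = γ t := by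
    intro t ht
    obtain ⟨h1, h2, h3⟩ := hδ (y := t) (by simpa [Real.dist_eq] using ht)
    refine ⟨by simpa [sub_zero] using h1, hγS t h3, φ.left_inv ?_⟩
    rw [hφ, extChartAt_source]
    exact h2
  -- Step 5: the radius
  obtain ⟨R, hR⟩ : ∃ R : ℝ, R = 1 + lam * ‖Lc‖ + ρ := ⟨_, rfl⟩
  have hR1 : 1 ≤ R := by rw [hR]; nlinarith [norm_nonneg Lc]
  have hR0 : 0 < R := by linarith
  obtain ⟨r, hr⟩ : ∃ r : ℝ, r = min (δ₁ / lam) (ρ / R) := ⟨_, rfl⟩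
  have hr0 : 0 < r := by rw [hr]; exact lt_min (by positivity) (by positivity)
  rw [Metric.eventually_nhds_iff]
  refine ⟨r, hr0, fun z hz hzS ↦ ?_⟩
  rw [dist_eq_norm] at hz
  have hy1 : lam * ‖z - c₀‖ < δ₁ := by
    have h := hz.trans_le (hr ▸ min_le_left _ _)
    rwa [lt_div_iff₀ hlam, mul_comm] at h
  have hy2 : ‖z - c₀‖ * R < ρ := by
    have h := hz.trans_le (hr ▸ min_le_right _ _)
    rwa [lt_div_iff₀ hR0] at h
  have hyρ : ‖z - c₀‖ < ρ := by nlinarith [norm_nonneg (z - c₀)]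
  -- the goal through `B`
  have hgoal : g.val (γ 0) (e.symmL ℝ (γ 0) (z - c₀)) L = B (z - c₀) Lc := by rw [hB, hLc']
  rw [hgoal]
  rcases eq_or_ne (z - c₀) 0 with hy0 | hy0
  · rw [hy0, map_zero, zero_apply, abs_zero, norm_zero, mul_zero]
  have hypos : 0 < ‖z - c₀‖ := norm_pos_iff.mpr hy0
  obtain ⟨s, hs⟩ : ∃ s : ℝ, s = lam * ‖z - c₀‖ := ⟨_, rfl⟩
  have hs0 : 0 < s := by rw [hs]; exact mul_pos hlam hypos
  have hsδ : |s| < δ₁ := by rw [abs_of_pos hs0, hs]; exact hy1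
  have hsδ' : |(-s)| < δ₁ := by rw [abs_neg]; exact hsδ
  have hθs : θ * s = ρ / 2 * ‖z - c₀‖ := by rw [hs, ← mul_assoc, hθlam]
  -- the curve endpoints `φ (γ (±s))` are `ρ`-close to `c₀`
  have hend : ∀ t : ℝ, |t| = s → ‖φ (γ t) - c₀ - t • Lc‖ ≤ θ * |t| →
      ‖φ (γ t) - c₀‖ < ρ := by
    intro t hts hrem
    have e1 : φ (γ t) - c₀ = (φ (γ t) - c₀ - t • Lc) + t • Lc := (sub_add_cancel _ _).symm
    rw [e1]
    calc ‖φ (γ t) - c₀ - t • Lc + t • Lc‖ ≤ ‖φ (γ t) - c₀ - t • Lc‖ + ‖t • Lc‖ :=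
          norm_add_le _ _
      _ ≤ θ * |t| + |t| * ‖Lc‖ := by
          rw [norm_smul, Real.norm_eq_abs]; linarith [hrem]
      _ = ‖z - c₀‖ * (ρ / 2 + lam * ‖Lc‖) := by rw [hts, hθs, hs]; ring
      _ ≤ ‖z - c₀‖ * R := by
          apply mul_le_mul_of_nonneg_left _ (norm_nonneg _)
          rw [hR]; linarith
      _ < ρ := hy2
  refine abs_le.mpr ⟨?_, ?_⟩
  · -- `B(y, L̂) < -μ ‖y‖` is impossible: shoot from `γ (-s)` to `φ⁻¹ z`
    by_contra hcon
    push Not at hcon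
    obtain ⟨hrem, hγs, hinv⟩ := hcurve (-s) hsδ'
    have hfut := hseg (φ (γ (-s))) (z - φ (γ (-s))) (z - c₀) ‖z - c₀‖ hypos le_rfl
      (by linarith) ?_ (hend (-s) (by rw [abs_neg, abs_of_pos hs0]) hrem)
      (by rwa [add_sub_cancel])
    · rw [add_sub_cancel, hinv] at hfut
      exact hS (γ (-s)) hγs (φ.symm z) hzS hfut
    · have e1 : z - φ (γ (-s)) - ((z - c₀) + (‖z - c₀‖ * lam) • Lc) =
          -(φ (γ (-s)) - c₀ - (-s) • Lc) := by
        rw [hs]; module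
      rw [e1, norm_neg]
      calc ‖φ (γ (-s)) - c₀ - (-s) • Lc‖ ≤ θ * |(-s)| := hrem
        _ = ρ / 2 * ‖z - c₀‖ := by rw [abs_neg, abs_of_pos hs0, hθs]
        _ < ρ * ‖z - c₀‖ := by nlinarith
  · -- `B(y, L̂) > μ ‖y‖` is impossible: shoot from `φ⁻¹ z` to `γ s`
    by_contra hcon
    push Not at hcon
    obtain ⟨hrem, hγs, hinv⟩ := hcurve s hsδ
    have hfut := hseg z (φ (γ s) - z) (-(z - c₀)) ‖z - c₀‖ hypos (by rw [norm_neg])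
      (by rw [map_neg, neg_apply]; linarith) ?_ hyρ ?_
    · rw [add_sub_cancel, hinv] at hfut
      exact hS (φ.symm z) hzS (γ s) hγs hfut
    · have e1 : φ (γ s) - z - (-(z - c₀) + (‖z - c₀‖ * lam) • Lc) = φ (γ s) - c₀ - s • Lc := by
        rw [hs]; module
      rw [e1]
      calc ‖φ (γ s) - c₀ - s • Lc‖ ≤ θ * |s| := hrem
        _ = ρ / 2 * ‖z - c₀‖ := by rw [abs_of_pos hs0, hθs]
        _ < ρ * ‖z - c₀‖ := by nlinarith
    · rw [add_sub_cancel]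
      exact hend s (abs_of_pos hs0) hrem

end General

/-- **HR-S (null sandwich): an achronal boundary containing a two-sided null segment through `x₀`
is squeezed, at `x₀`, into an arbitrarily thin double cone about the null hyperplane `L^⊥`**
(read in any chart about `x₀`: the boundary points `φ⁻¹ z` near `x₀` satisfy
`|g(e⁻¹(z − φ x₀), L)| ≤ μ ‖z − φ x₀‖`) — differentiability of the horizon at interior points
of generators (Beem–Królak 1998), here for the event horizon `∂I⁻(M_ext)` of a stationary
asymptotically flat black hole: `I⁻(M_ext)` is a past set
(`LorentzianMetric.isPastSet_chronologicalPast`), so its boundary is achronal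
(`LorentzianMetric.IsPastSet.isAchronal_frontier`) and `hrSandwich_of_isAchronal` applies. -/
theorem stub_hr_sandwich : ∀ (𝓑 : StationaryAFBlackHole.{0}) (p x₀ : 𝓑.carrier) (L : TangentSpace (𝓡 4) x₀) (γ : ℝ → 𝓑.carrier) (ε : ℝ), x₀ ∈ (chartAt E4 p).source → 0 < ε → γ 0 = x₀ → HasMFDerivAt 𝓘(ℝ, ℝ) (𝓡 4) γ 0 ((1 : ℝ →L[ℝ] ℝ).smulRight L) → 𝓑.metric.val x₀ L L = 0 → 𝓑.metric.val x₀ (𝓑.timeOrientation.vectorField x₀) L < 0 → (∀ t ∈ Set.Ioo (-ε) ε, γ t ∈ frontier (𝓑.metric.chronologicalPast 𝓑.timeOrientation 𝓑.Mext)) → ∀ μ : ℝ, 0 < μ → ∀ᶠ z in 𝓝 (extChartAt (𝓡 4) p x₀), (extChartAt (𝓡 4) p).symm z ∈ frontier (𝓑.metric.chronologicalPast 𝓑.timeOrientation 𝓑.Mext) → |𝓑.metric.val x₀ ((trivializationAt E4 (TangentSpace (𝓡 4)) p).symmL ℝ x₀ (z - extChartAt (𝓡 4) p x₀)) L| ≤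 μ * ‖z - extChartAt (𝓡 4) p x₀‖ := by
  intro 𝓑 p x₀ L γ ε hx₀ hε hγ0 hγd hLL hTL hγS μ hμ
  exact hrSandwich_of_isAchronal
    ((LorentzianMetric.isPastSet_chronologicalPast (g := 𝓑.metric) (τ := 𝓑.timeOrientation)
      𝓑.Mext).isAchronal_frontier) hx₀ hε hγ0 hγd hLL hTL hγS hμ

end Summit.FinalStateConjecture.FinalStateConjecture.Theorems.HawkingExtensionIsKerr.SketchIdeator2

end
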